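import Mathlib
import Literature.Computability.AlgebraicComplexity.FixedPointLog
import Summits.RiemannHypothesis.RiemannHypothesis.Theorems.WeilFormatCPrimeFormBound
import Summits.RiemannHypothesis.RiemannHypothesis.Theorems.WeilFormatCPrimeFormJoint
import Summits.RiemannHypothesis.RiemannHypothesis.Theorems.WeilFormatCPrimeFormJointOf
import HarnessLib

/-!
# Format C: PRIME ⪰ −A·1 from a SEVEN-term joint shift bound (windows `e^{2a} < 11`: the `log 3` and W-M5 cells)

Helper file (`--supports stmt-RiemannHypothesis-0098`, lead-track anchor; format C far bound), RH-free.  Seat rh-explicit-weil-1 (gen3).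
`WeilFormatCPrimeFormJointOf.lean` turns a certified FIVE-term real joint shift bound (window prime powers `2,3,4,5,7`, `a ≤ 10397/10000`)
into hypothesis `hP` of `WeilFormatC.farBlock_ge_dhat`.  This file is the analogue for the next two cells of the ladder, `(log 8)/2 < a < (log 11)/2`
(window prime powers `2, 3, 4, 5, 7, 8, 9`; `Λ(8) = log 2`, `Λ(9) = log 3`, `Λ(6) = Λ(10) = 0`): for every `0 < a ≤ 1198/1000` and every real `A`
such that the SEVEN-term real bound

  `Σ_{n=2,3,4,5,7,8,9} 2(Λ(n)/√n) ∫ u(x − log n) u(x) dx ≤ A · ∫ u²`   (all real measurable bounded `u` vanishing off `[−a, a]`)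

holds (for `a` below `(log 9)/2` or `(log 8)/2` the extra terms vanish on both sides, so the five-term certificates also fit),

* `WeilFormatC.primeCoeff_form_ge_of_jointShiftBound7` — **`−A·Σ_{n∈s}|c_n|² ≤ Σ_{n,m∈s} Re(conj c_n c_m)·primeCoeff a n m`**.

The numerical input `e^{2a} < 11` for `a ≤ 1198/1000` is certified from the tree's fixed-point logarithm (`FixedPoint.logNatLo 40 16 3 11`,
`FixedPoint.logNatLo_sound`).  Route-K3 cell certificates for these windows: WEIL1-SIZELAW.md §7.1 (log 3: D ≈ 2.36–2.41; 1.198: ≈ 2.78).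
Standard axioms only; no definitions.
-/

set_option autoImplicit false
set_option linter.dupNamespace false

noncomputable section

open Complex Set MeasureTheory Finset
open scoped Real ComplexConjugate BigOperators ArithmeticFunction.vonMangoldt

namespace Summit.RiemannHypothesis.RiemannHypothesis.Theorems.WeilFormatC

open Literature.NumberTheory.LFunctions Literature.NumberTheory.LFunctions.Yoshida1992
open Literature.Computability.AlgebraicComplexity

section Of7

variable {a : ℝ} {f : ℝ → ℂ}

/-- `2.396 < log 11`, certified by the tree's fixed-point logarithm (`logNatLo 40 16 3 11 = 2636513734607 ≤ 2^40·log 11`). -/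
theorem lt_log_eleven : (2396 / 1000 : ℝ) < Real.log 11 := by
  have hv : FixedPoint.logNatLo 40 16 3 11 = 2636513734607 := by decide +kernel
  have hs := FixedPoint.logNatLo_sound 40 16 (e := 3) (m := 11) (by norm_num) (by norm_num)
  rw [hv] at hs
  have hs' : ((2636513734607 : ℕ) : ℝ) ≤ (2 : ℝ) ^ 40 * Real.log 11 := by exact_mod_cast hs
  have h1 : (2 : ℝ) ^ 40 = 1099511627776 := by norm_num
  rw [h1] at hs'
  have h2 : ((2636513734607 : ℕ) : ℝ) = 2636513734607 := by norm_num
  rw [h2] at hs'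
  have : (2396 / 1000 : ℝ) * 1099511627776 < 2636513734607 := by norm_num
  linarith

/-- `e^{2a} < 11` for `a ≤ 1198/1000`. -/
theorem exp_two_mul_lt_eleven (ha' : a ≤ 1198 / 1000) : Real.exp (2 * a) < 11 := by
  have hlt : 2 * a < Real.log 11 := by have := lt_log_eleven; linarith
  calc Real.exp (2 * a) < Real.exp (Real.log 11) := Real.exp_lt_exp.2 hlt
    _ = 11 := Real.exp_log (by norm_num)

/-- For `a ≤ 1198/1000`: a sum over `weilPrimeIndex a` of terms vanishing when `2a ≤ log k` is the sum over `k < 11`. -/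
theorem sum_weilPrimeIndex_eq_sum_range_eleven (ha' : a ≤ 1198 / 1000) (F : ℕ → ℝ)
    (hF : ∀ k : ℕ, 2 * a ≤ Real.log k → F k = 0) :
    ∑ k ∈ weilPrimeIndex a, F k = ∑ k ∈ Finset.range 11, F k := by
  have hsub : weilPrimeIndex a ⊆ Finset.range 11 := by
    intro k hk
    have hk' := mem_weilPrimeIndex.1 hk
    rw [Finset.mem_range]
    by_contra hge
    push Not at hge
    have hk11 : (11 : ℝ) ≤ k := by exact_mod_cast hge
    have : Real.log 11 ≤ Real.log k := Real.log_le_log (by norm_num) hk11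
    have h11 : 2 * a < Real.log 11 := by
      have h := Real.log_lt_log (Real.exp_pos _) (exp_two_mul_lt_eleven ha')
      rwa [Real.log_exp] at h
    linarith
  refine Finset.sum_subset hsub fun k _ hk ↦ ?_
  refine hF k ?_
  by_contra hlt
  push Not at hlt
  exact hk (mem_weilPrimeIndex.2 hlt)

/-- The von Mangoldt values at `8, 9, 10`. -/
theorem vonMangoldt_values_8_9_10 : Λ 8 = Real.log 2 ∧ Λ 9 = Real.log 3 ∧ Λ 10 = 0 := by
  refine ⟨?_, ?_, ?_⟩
  · rw [show (8 : ℕ) = 2 ^ 3 by norm_num, ArithmeticFunction.vonMangoldt_apply_pow (by norm_num)]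
    exact ArithmeticFunction.vonMangoldt_apply_prime Nat.prime_two
  · rw [show (9 : ℕ) = 3 ^ 2 by norm_num, ArithmeticFunction.vonMangoldt_apply_pow two_ne_zero]
    exact ArithmeticFunction.vonMangoldt_apply_prime Nat.prime_three
  · exact ArithmeticFunction.vonMangoldt_eq_zero_iff.2 (by decide)

/-- **Seven-term joint shift bound for a complex window function from a real one.** -/
theorem joint_re_integral_shift_le_of7 {A : ℝ}
    (hJ : ∀ (u : ℝ → ℝ) (C : ℝ), Measurable u → (∀ x, |u x| ≤ C) → (∀ x, x ∉ Icc (-a) a → u x = 0) →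
      2 * (Real.log 2 / Real.sqrt 2) * (∫ x, u (x - Real.log 2) * u x) +
        2 * (Real.log 3 / Real.sqrt 3) * (∫ x, u (x - Real.log 3) * u x) +
        2 * (Real.log 2 / 2) * (∫ x, u (x - 2 * Real.log 2) * u x) +
        2 * (Real.log 5 / Real.sqrt 5) * (∫ x, u (x - Real.log 5) * u x) +
        2 * (Real.log 7 / Real.sqrt 7) * (∫ x, u (x - Real.log 7) * u x) +
        2 * (Real.log 2 / Real.sqrt 8) * (∫ x, u (x - 3 * Real.log 2) * u x) +
        2 * (Real.log 3 / 3) * (∫ x, u (x - 2 * Real.log 3) * u x) ≤ A * ∫ x, u x ^ 2)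
    (hf : IsWindowFunction a f) :
    2 * (Real.log 2 / Real.sqrt 2) * (∫ x, f (x + Real.log 2) * conj (f x)).re +
      2 * (Real.log 3 / Real.sqrt 3) * (∫ x, f (x + Real.log 3) * conj (f x)).re +
      2 * (Real.log 2 / 2) * (∫ x, f (x + 2 * Real.log 2) * conj (f x)).re +
      2 * (Real.log 5 / Real.sqrt 5) * (∫ x, f (x + Real.log 5) * conj (f x)).re +
      2 * (Real.log 7 / Real.sqrt 7) * (∫ x, f (x + Real.log 7) * conj (f x)).re +
      2 * (Real.log 2 / Real.sqrt 8) * (∫ x, f (x + 3 * Real.log 2) * conj (f x)).re +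
      2 * (Real.log 3 / 3) * (∫ x, f (x + 2 * Real.log 3) * conj (f x)).re
      ≤ A * ∫ x, ‖f x‖ ^ 2 := by
  obtain ⟨S, hS0, hS⟩ := hf.bounded'
  have hre : ∀ x, |(f x).re| ≤ S := fun x ↦ (Complex.abs_re_le_norm _).trans (hS x)
  have him : ∀ x, |(f x).im| ≤ S := fun x ↦ (Complex.abs_im_le_norm _).trans (hS x)
  have hmr : Measurable fun x ↦ (f x).re := Complex.measurable_re.comp hf.measurable
  have hmi : Measurable fun x ↦ (f x).im := Complex.measurable_im.comp hf.measurable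
  have hzr : ∀ x, x ∉ Icc (-a) a → (f x).re = 0 := fun x hx ↦ by rw [hf.eq_zero x hx, Complex.zero_re]
  have hzi : ∀ x, x ∉ Icc (-a) a → (f x).im = 0 := fun x hx ↦ by rw [hf.eq_zero x hx, Complex.zero_im]
  have hu := hJ (fun y ↦ (f y).re) S hmr hre hzr
  have hv := hJ (fun y ↦ (f y).im) S hmi him hzi
  have hsplit : ∀ t : ℝ, (∫ x, f (x + t) * conj (f x)).re =
      (∫ x, (fun y ↦ (f y).re) (x - t) * (fun y ↦ (f y).re) x) +
        ∫ x, (fun y ↦ (f y).im) (x - t) * (fun y ↦ (f y).im) x := by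
    intro t
    rw [re_integral_shift_mul_conj hf t,
      integral_add (integrable_shift_mul_of_window hmr hre hmr hre hzr t)
        (integrable_shift_mul_of_window hmi him hmi him hzi t)]
    simp only
    rw [integral_shift_add_mul_eq_sub (fun y ↦ (f y).re) t, integral_shift_add_mul_eq_sub (fun y ↦ (f y).im) t]
  rw [hsplit, hsplit, hsplit, hsplit, hsplit, hsplit, hsplit, integral_norm_sq_eq_add hf]
  simp only at hu hv ⊢
  nlinarith [hu, hv]

/-- **PRIME ⪰ −A·1 on every finite set of modes, for every window `0 < a ≤ 1198/1000` and every constant `A` of a real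
SEVEN-term joint shift bound on `[−a, a]`** (hypothesis `hP` of `WeilFormatC.farBlock_ge_dhat`). -/
theorem primeCoeff_form_ge_of_jointShiftBound7 (ha : 0 < a) (ha' : a ≤ 1198 / 1000) {A : ℝ}
    (hJ : ∀ (u : ℝ → ℝ) (C : ℝ), Measurable u → (∀ x, |u x| ≤ C) → (∀ x, x ∉ Icc (-a) a → u x = 0) →
      2 * (Real.log 2 / Real.sqrt 2) * (∫ x, u (x - Real.log 2) * u x) +
        2 * (Real.log 3 / Real.sqrt 3) * (∫ x, u (x - Real.log 3) * u x) +
        2 * (Real.log 2 / 2) * (∫ x, u (x - 2 * Real.log 2) * u x) +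
        2 * (Real.log 5 / Real.sqrt 5) * (∫ x, u (x - Real.log 5) * u x) +
        2 * (Real.log 7 / Real.sqrt 7) * (∫ x, u (x - Real.log 7) * u x) +
        2 * (Real.log 2 / Real.sqrt 8) * (∫ x, u (x - 3 * Real.log 2) * u x) +
        2 * (Real.log 3 / 3) * (∫ x, u (x - 2 * Real.log 3) * u x) ≤ A * ∫ x, u x ^ 2)
    (s : Finset ℤ) (c : ℤ → ℂ) :
    -(A * ∑ n ∈ s, ‖c n‖ ^ 2) ≤ ∑ n ∈ s, ∑ m ∈ s, (conj (c n) * c m).re * primeCoeff a n m := by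
  set f : ℝ → ℂ := ∑ n ∈ s, c n • chi a n with hfdef
  have hf : IsWindowFunction a f := IsWindowFunction.sum s c fun n _ ↦ isWindowFunction_chi ha n
  set X : ℕ → ℝ := fun k ↦ 2 * (∫ x, f (x + Real.log k) * conj (f x)).re with hXdef
  have e : ∑ n ∈ s, ∑ m ∈ s, (conj (c n) * c m).re * primeCoeff a n m
      = ∑ k ∈ weilPrimeIndex a, -((Λ k : ℝ) / Real.sqrt k * X k) := by
    calc ∑ n ∈ s, ∑ m ∈ s, (conj (c n) * c m).re * primeCoeff a n m
        = ∑ n ∈ s, ∑ m ∈ s, ∑ k ∈ weilPrimeIndex a, (Λ k : ℝ) / Real.sqrt k *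
            ((conj (c n) * c m).re * (incrCoeff a (Real.log k) n m - if n = m then 2 else 0)) := by
          refine Finset.sum_congr rfl fun n _ ↦ Finset.sum_congr rfl fun m _ ↦ ?_
          rw [primeCoeff, Finset.mul_sum]
          refine Finset.sum_congr rfl fun k _ ↦ by ring
      _ = ∑ n ∈ s, ∑ k ∈ weilPrimeIndex a, ∑ m ∈ s, (Λ k : ℝ) / Real.sqrt k *
            ((conj (c n) * c m).re * (incrCoeff a (Real.log k) n m - if n = m then 2 else 0)) :=
          Finset.sum_congr rfl fun n _ ↦ Finset.sum_comm
      _ = ∑ k ∈ weilPrimeIndex a, ∑ n ∈ s, ∑ m ∈ s, (Λ k : ℝ) / Real.sqrt k *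
            ((conj (c n) * c m).re * (incrCoeff a (Real.log k) n m - if n = m then 2 else 0)) :=
          Finset.sum_comm
      _ = ∑ k ∈ weilPrimeIndex a, (Λ k : ℝ) / Real.sqrt k *
            ∑ n ∈ s, ∑ m ∈ s, (conj (c n) * c m).re * (incrCoeff a (Real.log k) n m - if n = m then 2 else 0) := by
          refine Finset.sum_congr rfl fun k _ ↦ ?_
          rw [Finset.mul_sum]
          refine Finset.sum_congr rfl fun n _ ↦ ?_
          rw [Finset.mul_sum]
      _ = ∑ k ∈ weilPrimeIndex a, -((Λ k : ℝ) / Real.sqrt k * X k) := by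
          refine Finset.sum_congr rfl fun k hk ↦ ?_
          by_cases hΛ : (Λ k : ℝ) = 0
          · rw [hΛ]; simp
          have hk2 : 2 ≤ k := by
            by_contra h
            have : k = 0 ∨ k = 1 := by omega
            rcases this with rfl | rfl
            · exact hΛ (by simp)
            · exact hΛ (by simp)
          have ht : 0 < Real.log k := Real.log_pos (by exact_mod_cast hk2)
          have ht2 : Real.log k ≤ 2 * a := (mem_weilPrimeIndex.1 hk).le
          rw [sum_sum_re_mul_incrCoeff_sub_two_eq ha s c ht.le ht2, hXdef]
          ring
  have hXzero : ∀ k : ℕ, 2 * a ≤ Real.log k → X k = 0 := by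
    intro k hk
    obtain ⟨S, hS0, hS⟩ := hf.bounded'
    have hre : ∀ x, |(f x).re| ≤ S := fun x ↦ (Complex.abs_re_le_norm _).trans (hS x)
    have him : ∀ x, |(f x).im| ≤ S := fun x ↦ (Complex.abs_im_le_norm _).trans (hS x)
    have hmr : Measurable fun x ↦ (f x).re := Complex.measurable_re.comp hf.measurable
    have hmi : Measurable fun x ↦ (f x).im := Complex.measurable_im.comp hf.measurable
    have hzr : ∀ x, x ∉ Icc (-a) a → (f x).re = 0 := fun x hx ↦ by rw [hf.eq_zero x hx, Complex.zero_re]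
    have hzi : ∀ x, x ∉ Icc (-a) a → (f x).im = 0 := fun x hx ↦ by rw [hf.eq_zero x hx, Complex.zero_im]
    simp only [hXdef]
    rw [re_integral_shift_mul_conj hf,
      integral_add (integrable_shift_mul_of_window hmr hre hmr hre hzr _)
        (integrable_shift_mul_of_window hmi him hmi him hzi _)]
    rw [integral_shift_add_mul_eq_sub (fun y ↦ (f y).re), integral_shift_add_mul_eq_sub (fun y ↦ (f y).im),
      integral_shift_mul_eq_zero_of_le hzr hk, integral_shift_mul_eq_zero_of_le hzi hk]
    ring
  have hsum : ∑ k ∈ weilPrimeIndex a, -((Λ k : ℝ) / Real.sqrt k * X k) =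
      ∑ k ∈ Finset.range 11, -((Λ k : ℝ) / Real.sqrt k * X k) :=
    sum_weilPrimeIndex_eq_sum_range_eleven ha' _ fun k hk ↦ by rw [hXzero k hk, mul_zero, neg_zero]
  obtain ⟨hΛ0, hΛ1, hΛ2, hΛ3, hΛ4, hΛ5, hΛ6, hΛ7⟩ := vonMangoldt_values
  obtain ⟨hΛ8, hΛ9, hΛ10⟩ := vonMangoldt_values_8_9_10
  have hs4 : Real.sqrt ((4 : ℕ) : ℝ) = 2 := by
    rw [show ((4 : ℕ) : ℝ) = 2 ^ 2 by norm_num, Real.sqrt_sq (by norm_num)]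
  have hs9 : Real.sqrt ((9 : ℕ) : ℝ) = 3 := by
    rw [show ((9 : ℕ) : ℝ) = 3 ^ 2 by norm_num, Real.sqrt_sq (by norm_num)]
  have hjoint := joint_re_integral_shift_le_of7 hJ hf
  have hnorm := integral_norm_sq_sum_smul_chi ha s c
  rw [e, hsum]
  simp only [Finset.sum_range_succ, Finset.sum_range_zero, hΛ0, hΛ1, hΛ2, hΛ3, hΛ4, hΛ5, hΛ6, hΛ7, hΛ8, hΛ9, hΛ10,
    zero_div, zero_mul, neg_zero, zero_add, add_zero, hs4, hs9, hXdef]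
  rw [← hnorm]
  have h4 : Real.log ((4 : ℕ) : ℝ) = 2 * Real.log 2 := by
    rw [show ((4 : ℕ) : ℝ) = 2 ^ 2 by norm_num, Real.log_pow]; norm_num
  have h8 : Real.log ((8 : ℕ) : ℝ) = 3 * Real.log 2 := by
    rw [show ((8 : ℕ) : ℝ) = 2 ^ 3 by norm_num, Real.log_pow]; norm_num
  have h9 : Real.log ((9 : ℕ) : ℝ) = 2 * Real.log 3 := by
    rw [show ((9 : ℕ) : ℝ) = 3 ^ 2 by norm_num, Real.log_pow]; norm_num
  simp only [Nat.cast_ofNat] at h4 h8 h9 ⊢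
  rw [h4, h8, h9]
  nlinarith [hjoint]

end Of7

end Summit.RiemannHypothesis.RiemannHypothesis.Theorems.WeilFormatC
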